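import Literature.MathematicalPhysics.QuantumFieldTheory.Balaban1983to89.B8Thm4ConcreteLanEGamma
import Literature.MathematicalPhysics.QuantumFieldTheory.Balaban1983to89.B8Thm4CoreZd3LanE
import Literature.MathematicalPhysics.QuantumFieldTheory.Balaban1983to89.B8LeafModelZd3P

/-!
# `Balaban1983to89.B8Thm4CoreZdGF3HPLanEGamma` — [Balaban1985RegularSpaces] Thm 4 p. 88 ∕ Thm 8 (1.146) p. 101: the Theorem-4-shaped CORE AT THE P-CARRIER
# `B8LeafModelZd3P.zdGF3HP` (dag-n05-w1: (1.37)∕(1.42) on print's class `towerBondsP`, (1.35)∕(1.66) in print's one-end-point class, Theorem 8's source space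
# as printed), source-indexed gauge predicate, Prop. 5's uniqueness socket in the E currency — `B8Thm4CoreZd3LanE.thm4Core_zd3_lanE` RE-RUN on the P-carrier
# in EDITION γ′ (D7-3(B) of the `Ω₀ = ℤᵈ` road's γ chain; plan START-LIST v3 §n05)

statement-level skeleton of published theorems with citation tags; proofs where landed; nothing here is a claim about the Yang–Mills mass gap

T. Bałaban, *Spaces of regular gauge field configurations on a lattice and gauge fixing conditions*, Commun. Math. Phys. **99** (1985) 75–102
`[Balaban1985RegularSpaces]` ("B8"): Thm 4 p. 88, (1.29) p. 81, (1.31) p. 82, (1.35) p. 82, (1.37)–(1.38) p. 82, (1.62) p. 87, Prop. 5 p. 94, pp. 94–95, Thm 8 (1.146)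
p. 101, p. 77 (bond convention; (1.5)–(1.6) towers).  PDF held: `paper:balaban1985-cmp99-regular-spaces-gauge-fixing` (journal page = PDF page + 74).

CITATION HEADER (lean-in-tree rule).  Cell `pub-ymgap` (HUMAN RULING D-0062, Track A), DAG node N05 = [B8], seat `pub-ymgap-dag-n05-d` (g10; R134 row s2).
WHY THIS FILE.  `B8Thm4CoreZd3LanE` is the member-level Theorem-4∕8 core the Thm-8 knit `B8Thm8SurvivingZd3MapHE` (this seat's p521275 road) reads — on n05-a's
carrier `zdGF3`, i.e. with (1.37)∕(1.42) on the member's own class `i.Λb` and (1.35) at «box ⊂ Ω_j»; this seat's `B8Prop3ShellModeVacuity` (p585094) shows the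
SLOT built on that carrier is EMPTY as typed.  On the P-carrier (bus convergence 2026-08-28 00:05–00:14Z) the class is print's and (1.35) is the one-end-point
letter; dag-n05-w2's `H42_of_inAx_γ'` (p587580) reads exactly that letter (+ the tower law at the truncation), and this seat's γ′ existence
(`B8Prop3GaugeFixedKLevelSrcGammaPrime` p590251) ∕ concrete body (`B8Thm4ConcreteLanEGamma`) carry it through — so NO one-level-up bridge and NO constant inflation.

WHAT THIS FILE PROVES (two theorems, no `def`).
★★ `thm4Core_zdGF3HP_lanE_γ'` — `thm4Core_zd3_lanE`'s sentence with: carrier `zdGF3HP`; the member's sockets `SP5base SP5 SH59src SP5u` stated with the ONE-END-POINT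
(1.35) antecedent and (for `SH59src`) the averaging datum `|B₁|` over `towerBondsP L i.Ω (i.Λs m) ·` (= dag-n06-b's `sockH59srcP_univ_explicit_on_lin` shape at that
class; providers: dag-n05-w4's γ′ Src chain); ONE extra member hypothesis — the tower law at every truncation (`IdxB8Sub.tower_all` at the law members); conclusion
= existence of a restricted `u` with the P-carrier's `C137 α₁` (print's class), `LanF i U₀ φ i.k`, `C162 (5dL·B₈) (α₀+α₁)`, and uniqueness.  Proof = the
original's with `thm4Body_concrete_uniform_lanE_γ'`, `ZdIdx.towerBondsP_laws`, `thm4_windows_γ`, `H42_of_inAx_γ'` BY NAME.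
★★ `thm4Core_zdGF3HP_map_lanE_γ'` — the same over an arbitrary index map `ι : J → ZdIdx d L` (sockets, the tower law and the conclusion AT `ι a`), by the
source-index enlargement `J × Φ` (this seat's `B8Thm8SurvivingZd3MapHE.thm4Core_zd3_map_lanE`, three lines) — the core the γ′ Theorem-8 knit reads.

HONEST SCOPE.  Assembly BY NAME; the four sockets are HYPOTHESES; nothing of Theorem 4∕8's analysis is proved here; count-neutral; N05 NOT discharged; `≤` where
print has `<`; `T_η ↦ ℤᵈ`; one finite `T⁴` programme at fixed `ε` — nothing continuum ∕ ℝ⁴ ∕ OS ∕ mass-gap ∕ Clay.  No `sorry`, no `def`, no `instance`, no `notation`.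
Unit `pub-ymgap-dag-n05-d` (g10), 2026-08-28.
-/

noncomputable section

open NormedSpace

namespace Literature.MathematicalPhysics.QuantumFieldTheory.Balaban1983to89.B8Thm4CoreZdGF3HPLanEGamma

open Complex (I)
open MatrixLog B7Prop1Explicit B7Prop2Explicit B7Prop1Local B7Eq92Concrete
open B7Prop2Explicit (C0 c2' unitaryUnits unitaryUnits_le_U1)
open B8Ineq132 (covDerivFwd InAk BondTouches)
open B8Eq119TwistedAxial (Restr129 InAx)
open B8Eq184Proof (gaugeExp cfgExp)
open B8Lemma1NonAbelian (mulCfg)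
open B8Eq140Level (SideTouches)
open B8Eq146AExpansion (iEta)
open B7Prop4GeneralLevels (logCovIter linCovIter)
open B8Eq155JBound (Jcur wsup)
open B8ScaledSupNorm (bondNorm msup)
open B8Thm2LogB (blockTop)
open B8Ineq130 (tlo thi)
open B8Eq138LandauZd (logCfg)
open B8Prop3GaugeFixedKLevel (mem_unitaryUnits_of_mgauge_eq)
open B8Thm4AtLandau138 (mgauge_mgauge_inv)
open B8Thm4ConcreteLanEGamma (thm4Body_concrete_uniform_lanE_γ')
open B8Thm4Windows (thm4_windows thm4_windows_extra)
open B8Thm4ExistsConcreteGamma (thm4_windows_γ)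
open B8LeafModelZd (ZdIdx)
open B8LeafModelZd3 (zdGF3 mlogCfg mlogCfg_spec)
open B8LeafModelZd3P (zdGF3P zdGF3HP)
open B8TowerBondsPrinted (towerBondsP)

-- `Site` alone could resolve to the torus sites of `Setup.lean`; re-export the `ℤ^d` sites of `B7Prop1Explicit`.
export B7Prop1Explicit (Site)

variable {d : ℕ}

section Core

variable {𝔸 : Type} [CStarAlgebra 𝔸] [Nontrivial 𝔸]

/-- ★★ **THEOREM 4 ∕ THEOREM 8, THE THEOREM-4-SHAPED CORE AT THE P-CARRIER `zdGF3HP` (EDITION γ′), SOURCE-INDEXED GAUGE PREDICATE, PROPOSITION 5's UNIQUENESS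
SOCKET IN THE REPAIRED («E») CURRENCY** — `B8Thm4CoreZd3LanE.thm4Core_zd3_lanE` on dag-n05-w1's P-carrier: the averaging-datum class is PRINT's
`towerBondsP L i.Ω (i.Λs m) j` (laws `B8TowerBondsPrinted.ZdIdx.towerBondsP_laws`), (1.35) is the carrier's one-end-point letter (also in every socket's
antecedent), the member supplies its tower law at every truncation, the body is `B8Thm4ConcreteLanEGamma.thm4Body_concrete_uniform_lanE_γ'`, (1.37) by
dag-n05-w2's `H42_of_inAx_γ'` with the γ windows of `thm4_windows_γ` (module docstring; `B8Thm4CoreZd3Lan.thm4Core_zd3_lan` with the binder `SP5u` := `SockP5uE`'s text member-ised at `LanF i`):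
for `d, L ≥ 2`, the [4] constant `B₀ > 0`, `B₀′ > 0`, Prop. 5's radius `cu > 0`, the providers' threshold `cP > 0`, source constants `γ′ ≥ 0` and
`B₈ ≥ B₀` with `5dLB₀ + 2γ′B₀ ≤ 5dLB₈`, `2 ≤ 5dLB₈`, any Hölder data `β, len` — MODULO, at every member `i`, the sourced sockets `SP5base` ∕
`SP5` (Prop. 5 at `LanF i`), `SH59src` ([4] Thm 3.3 + (1.57)–(1.58) with source, `+ γ′B₀(α₀ + α₁)`), `SP5u` (Prop. 5's uniqueness at `LanF i`):
ONE threshold `c₁` such that the carrier's (1.33) ∕ (1.34) ∕ (1.35)+(1.66)₀ at `(α₀, α₁)` and an admitted source `φ` give a restricted `u` with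
(1.37) `C137 α₁`, `LanF i U₀ φ i.k` for `U′^{u⁻¹}`, the (1.62)-shape `C162 (5dL·B₈) (α₀ + α₁)`, unique among restricted competitors with the
gauge condition and the (1.62)-shape.  n05-a's `B8LeafModelZd3.thm4Printed_zd3` VERBATIM on `B8Thm4ConcreteLanE.thm4Body_concrete_uniform_lanE`;
(1.37) by `B8Eq142KLevelLocal.H42_of_inAx` at `Lan := LanF i U₀ φ`. [cite: Balaban1985RegularSpaces, Thm 8 (1.146) p.101, Thm 4 p.88, (1.29) p.81, (1.37)–(1.38) p.82, (1.62) p.87, Prop. 5 p.94, pp.94–95] -/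
theorem thm4Core_zdGF3HP_lanE_γ' (hd2 : 2 ≤ d) {L : ℕ} (hL : 2 ≤ L) {β : ℝ} {len : Site d → ℝ} {B₀ B₀' cu cP : ℝ} (hB₀ : 0 < B₀)
    (hB₀' : 0 < B₀') (hcu : 0 < cu) (hcP : 0 < cP)
    {Φ : Type*} {γ' B₈ : ℝ} (hγ' : 0 ≤ γ') (hB₈ : 0 < B₈) (hB₀8 : B₀ ≤ B₈) (hB : 2 ≤ 5 * (d : ℝ) * L * B₈)
    (hγB : 5 * (d : ℝ) * L * B₀ + 2 * (γ' * B₀) ≤ 5 * (d : ℝ) * L * B₈)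
    (Adm : ZdIdx d L → Φ → (Site d → Fin d → 𝔸ˣ) → ℝ → ℝ → Prop)
    (LanF : ZdIdx d L → (Site d → Fin d → 𝔸ˣ) → Φ → ℕ → (Site d → Fin d → 𝔸ˣ) → Prop)
    (SP5base : ∀ i : ZdIdx d L, ∀ α₀ α₁ : ℝ, 0 < α₀ → 0 < α₁ → α₀ + α₁ ≤ cP →
      ∀ U₀ U' : Site d → Fin d → 𝔸ˣ, (∀ x κ, U₀ x κ ∈ unitaryUnits 𝔸) → (∀ x κ, U' x κ ∈ unitaryUnits 𝔸) →
      ∀ φ : Φ, Adm i φ U₀ α₀ α₁ →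
      InAk L i.k i.η α₀ i.Ω U₀ → InAk L i.k i.η α₀ i.Ω (mulCfg U' U₀) → (∀ m, m ≤ i.k → InAx L m (i.Λs m) U₀ (mulCfg U' U₀)) →
      (∀ j, j ≤ i.k → ∀ (z : Site d) (μ : Fin d),
        ((∀ x, InBox (tlo L z j) (thi L z j) x → x ∈ i.Ω j) ∨ (∀ x, InBox (tlo L (z + e μ) j) (thi L (z + e μ) j) x → x ∈ i.Ω j)) →
        ‖(avgIter L (mulCfg U' U₀) j z μ : 𝔸) - (avgIter L U₀ j z μ : 𝔸)‖ ≤ α₁) →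
      (∀ b ∈ {b : Site d × Fin d | SideTouches (i.Ω 0) b.1 b.2}, ‖((U' b.1 b.2 : 𝔸ˣ) : 𝔸) - 1‖ ≤ α₁) →
      (∃ (v : Site d → 𝔸ˣ) (lam : Site d → 𝔸), (∀ x, v x ∈ unitaryUnits 𝔸) ∧ (∀ x, x ∉ i.Ω 0 → v x = 1) ∧
        (∀ j, j ≤ 1 → ∀ b ∈ {b : Site d × Fin d | SideTouches (i.Ω j) b.1 b.2}, (v b.1 : 𝔸) = ((gaugeExp lam b.1 : 𝔸ˣ) : 𝔸) ∧
        (v (b.1 + e b.2) : 𝔸) = ((gaugeExp lam (b.1 + e b.2) : 𝔸ˣ) : 𝔸)) ∧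
        (∀ j, j ≤ 1 → ∀ b ∈ {b : Site d × Fin d | SideTouches (i.Ω j) b.1 b.2},
        ‖lam b.1‖ ≤ (8 * B₀' * (5 * (d : ℝ) * L * B₈) * (α₀ + α₁)) ∧ ((L : ℝ) ^ j * i.η) * ‖covDerivFwd i.η U₀ b.2 lam b.1‖ ≤ (8 * B₀' * (5 * (d : ℝ) * L * B₈) * (α₀ + α₁))) ∧
        LanF i U₀ φ 1 (mgauge U₀ v⁻¹ U') ∧ Restr129 L 1 (i.Λs 1) U₀ ((1 : Site d → 𝔸ˣ) * v)))
    (SP5 : ∀ i : ZdIdx d L, ∀ α₀ α₁ : ℝ, 0 < α₀ → 0 < α₁ → α₀ + α₁ ≤ cP →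
      ∀ U₀ U' : Site d → Fin d → 𝔸ˣ, (∀ x κ, U₀ x κ ∈ unitaryUnits 𝔸) → (∀ x κ, U' x κ ∈ unitaryUnits 𝔸) →
      ∀ φ : Φ, Adm i φ U₀ α₀ α₁ →
      InAk L i.k i.η α₀ i.Ω U₀ → InAk L i.k i.η α₀ i.Ω (mulCfg U' U₀) → (∀ m, m ≤ i.k → InAx L m (i.Λs m) U₀ (mulCfg U' U₀)) →
      (∀ j, j ≤ i.k → ∀ (z : Site d) (μ : Fin d),
        ((∀ x, InBox (tlo L z j) (thi L z j) x → x ∈ i.Ω j) ∨ (∀ x, InBox (tlo L (z + e μ) j) (thi L (z + e μ) j) x → x ∈ i.Ω j)) →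
        ‖(avgIter L (mulCfg U' U₀) j z μ : 𝔸) - (avgIter L U₀ j z μ : 𝔸)‖ ≤ α₁) →
      (∀ b ∈ {b : Site d × Fin d | SideTouches (i.Ω 0) b.1 b.2}, ‖((U' b.1 b.2 : 𝔸ˣ) : 𝔸) - 1‖ ≤ α₁) →
      (∀ m, 1 ≤ m → m < i.k → ∀ (u₁ : Site d → 𝔸ˣ) (U₁ : Site d → Fin d → 𝔸ˣ) (A : Site d → Fin d → 𝔸),
        (∀ x, u₁ x ∈ unitaryUnits 𝔸) → (∀ x, x ∉ i.Ω 0 → u₁ x = 1) → mgauge U₀ u₁ U₁ = U' → Restr129 L m (i.Λs m) U₀ u₁ →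
        LanF i U₀ φ m U₁ →
        (∀ j, j ≤ m → ∀ b ∈ {b : Site d × Fin d | SideTouches (i.Ω j) b.1 b.2},
        U₁ b.1 b.2 = cfgExp i.η A b.1 b.2 ∧ IsSelfAdjoint (A b.1 b.2) ∧ ‖A b.1 b.2‖ ≤ (5 * (d : ℝ) * L * B₈ * (α₀ + α₁)) * ((L : ℝ) ^ j * i.η)⁻¹) →
        ∃ (v : Site d → 𝔸ˣ) (lam : Site d → 𝔸), (∀ x, v x ∈ unitaryUnits 𝔸) ∧ (∀ x, x ∉ i.Ω 0 → v x = 1) ∧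
        (∀ j, j ≤ m + 1 → ∀ b ∈ {b : Site d × Fin d | SideTouches (i.Ω j) b.1 b.2}, (v b.1 : 𝔸) = ((gaugeExp lam b.1 : 𝔸ˣ) : 𝔸) ∧
        (v (b.1 + e b.2) : 𝔸) = ((gaugeExp lam (b.1 + e b.2) : 𝔸ˣ) : 𝔸)) ∧
        (∀ j, j ≤ m + 1 → ∀ b ∈ {b : Site d × Fin d | SideTouches (i.Ω j) b.1 b.2},
        ‖lam b.1‖ ≤ (8 * B₀' * (5 * (d : ℝ) * L * B₈) * (α₀ + α₁)) ∧ ((L : ℝ) ^ j * i.η) * ‖covDerivFwd i.η U₀ b.2 lam b.1‖ ≤ (8 * B₀' * (5 * (d : ℝ) * L * B₈) * (α₀ + α₁))) ∧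
        LanF i U₀ φ (m + 1) (mgauge U₀ v⁻¹ U₁) ∧ Restr129 L (m + 1) (i.Λs (m + 1)) U₀ (u₁ * v)))
    (SH59src : ∀ i : ZdIdx d L, ∀ α₀ α₁ : ℝ, 0 < α₀ → 0 < α₁ → α₀ + α₁ ≤ cP →
      ∀ U₀ U' : Site d → Fin d → 𝔸ˣ, (∀ x κ, U₀ x κ ∈ unitaryUnits 𝔸) → (∀ x κ, U' x κ ∈ unitaryUnits 𝔸) →
      ∀ φ : Φ, Adm i φ U₀ α₀ α₁ →
      InAk L i.k i.η α₀ i.Ω U₀ → InAk L i.k i.η α₀ i.Ω (mulCfg U' U₀) → (∀ m, m ≤ i.k → InAx L m (i.Λs m) U₀ (mulCfg U' U₀)) →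
      (∀ j, j ≤ i.k → ∀ (z : Site d) (μ : Fin d),
        ((∀ x, InBox (tlo L z j) (thi L z j) x → x ∈ i.Ω j) ∨ (∀ x, InBox (tlo L (z + e μ) j) (thi L (z + e μ) j) x → x ∈ i.Ω j)) →
        ‖(avgIter L (mulCfg U' U₀) j z μ : 𝔸) - (avgIter L U₀ j z μ : 𝔸)‖ ≤ α₁) →
      (∀ b ∈ {b : Site d × Fin d | SideTouches (i.Ω 0) b.1 b.2}, ‖((U' b.1 b.2 : 𝔸ˣ) : 𝔸) - 1‖ ≤ α₁) →
      (∀ m, 1 ≤ m → m ≤ i.k → ∀ (u : Site d → 𝔸ˣ) (W : Site d → Fin d → 𝔸ˣ) (A' : Site d → Fin d → 𝔸),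
        (∀ x, u x ∈ unitaryUnits 𝔸) → mgauge U₀ u W = U' → Restr129 L m (i.Λs m) U₀ u → LanF i U₀ φ m W →
        (∀ y τ, IsSelfAdjoint (A' y τ)) →
        (∀ j, j ≤ m → ∀ y τ, SideTouches (i.Ω j) y τ →
        W y τ = cfgExp i.η A' y τ ∧ ‖A' y τ‖ ≤ (2 * (L * (5 * (d : ℝ) * L * B₈ * (α₀ + α₁))) + 8 * (8 * B₀' * (5 * (d : ℝ) * L * B₈) * (α₀ + α₁))) * ((L : ℝ) ^ j * i.η)⁻¹) →
        (∀ y τ, (∀ j, j ≤ m → ¬ SideTouches (i.Ω j) y τ) → A' y τ = 0) →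
        msup L m i.η (-(1 : ℝ)) (fun j (b : Site d × Fin d) => SideTouches (i.Ω j) b.1 b.2) (fun b => A' b.1 b.2)
        ≤ B₀ * (bondNorm L m i.η (-(3 : ℝ)) i.Ω (fun x μ => Jcur i.η U₀ A' μ x)
        + wsup 1 (fun p : {p : ℕ × (Site d × Fin d) // p.1 ≤ m ∧ p.2 ∈ towerBondsP L i.Ω (i.Λs m) p.1} =>
        linCovIter L U₀ (iEta i.η A') p.1.1 p.1.2.1 p.1.2.2)) + γ' * B₀ * (α₀ + α₁) ∧
        msup L m i.η (-(2 : ℝ)) (fun j (t : Fin d × Fin d × Site d) => SideTouches (i.Ω j) t.2.2 t.2.1)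
        (fun t => covDerivFwd i.η U₀ t.1 (fun z => A' z t.2.1) t.2.2)
        ≤ B₀ * (bondNorm L m i.η (-(3 : ℝ)) i.Ω (fun x μ => Jcur i.η U₀ A' μ x)
        + wsup 1 (fun p : {p : ℕ × (Site d × Fin d) // p.1 ≤ m ∧ p.2 ∈ towerBondsP L i.Ω (i.Λs m) p.1} =>
        linCovIter L U₀ (iEta i.η A') p.1.1 p.1.2.1 p.1.2.2)) + γ' * B₀ * (α₀ + α₁)))
    (SP5u : ∀ i : ZdIdx d L, ∀ α₀ α₁ : ℝ, 0 < α₀ → 0 < α₁ → α₀ + α₁ ≤ cP →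
      ∀ U₀ U' : Site d → Fin d → 𝔸ˣ, (∀ x κ, U₀ x κ ∈ unitaryUnits 𝔸) → (∀ x κ, U' x κ ∈ unitaryUnits 𝔸) →
      ∀ φ : Φ, Adm i φ U₀ α₀ α₁ →
      InAk L i.k i.η α₀ i.Ω U₀ → InAk L i.k i.η α₀ i.Ω (mulCfg U' U₀) → (∀ m, m ≤ i.k → InAx L m (i.Λs m) U₀ (mulCfg U' U₀)) →
      (∀ j, j ≤ i.k → ∀ (z : Site d) (μ : Fin d),
        ((∀ x, InBox (tlo L z j) (thi L z j) x → x ∈ i.Ω j) ∨ (∀ x, InBox (tlo L (z + e μ) j) (thi L (z + e μ) j) x → x ∈ i.Ω j)) →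
        ‖(avgIter L (mulCfg U' U₀) j z μ : 𝔸) - (avgIter L U₀ j z μ : 𝔸)‖ ≤ α₁) →
      (∀ b ∈ {b : Site d × Fin d | SideTouches (i.Ω 0) b.1 b.2}, ‖((U' b.1 b.2 : 𝔸ˣ) : 𝔸) - 1‖ ≤ α₁) →
      ∀ u₁ : Site d → 𝔸ˣ, (∀ x, u₁ x ∈ unitaryUnits 𝔸) → (∀ x, x ∉ i.Ω 0 → u₁ x = 1) → Restr129 L i.k (i.Λs i.k) U₀ u₁ →
      LanF i U₀ φ i.k (mgauge U₀ u₁⁻¹ U') →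
      (∃ A₁ : Site d → Fin d → 𝔸, ∀ j, j ≤ i.k → ∀ (x : Site d) (κ : Fin d), SideTouches (i.Ω j) x κ →
        mgauge U₀ u₁⁻¹ U' x κ = cfgExp i.η A₁ x κ ∧ ‖A₁ x κ‖ ≤ (5 * (d : ℝ) * L * B₈ * (α₀ + α₁)) * ((L : ℝ) ^ j * i.η)⁻¹) →
      ∀ (v w : Site d → 𝔸ˣ) (lam mu : Site d → 𝔸),
      (∀ x, ((gaugeExp lam x : 𝔸ˣ) : 𝔸) = ((v x : 𝔸ˣ) : 𝔸) ∧ IsSelfAdjoint (lam x) ∧ ‖lam x‖ < cu) → (∀ x, x ∉ i.Ω 0 → lam x = 0) →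
      (∀ j, j ≤ i.k → ∀ b ∈ {b : Site d × Fin d | SideTouches (i.Ω j) b.1 b.2}, ((L : ℝ) ^ j * i.η) * ‖covDerivFwd i.η U₀ b.2 lam b.1‖ < cu) →
      (∀ x, ((gaugeExp mu x : 𝔸ˣ) : 𝔸) = ((w x : 𝔸ˣ) : 𝔸) ∧ IsSelfAdjoint (mu x) ∧ ‖mu x‖ < cu) → (∀ x, x ∉ i.Ω 0 → mu x = 0) →
      (∀ j, j ≤ i.k → ∀ b ∈ {b : Site d × Fin d | SideTouches (i.Ω j) b.1 b.2}, ((L : ℝ) ^ j * i.η) * ‖covDerivFwd i.η U₀ b.2 mu b.1‖ < cu) →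
      LanF i U₀ φ i.k (mgauge U₀ v⁻¹ (mgauge U₀ u₁⁻¹ U')) → Restr129 L i.k (i.Λs i.k) U₀ (u₁ * v) →
      LanF i U₀ φ i.k (mgauge U₀ w⁻¹ (mgauge U₀ u₁⁻¹ U')) → Restr129 L i.k (i.Λs i.k) U₀ (u₁ * w) →
      ∀ x, v x = w x) :
    ∃ c₁ : ℝ, 0 < c₁ ∧ ∀ i : ZdIdx d L,
      -- the tower law at EVERY truncation of the member ((1.5)–(1.6) p. 77; `IdxB8Sub.tower_all` at the law members)
      (∀ m, m ≤ i.k → ∀ j, j ≤ m → ∀ y ∈ i.Λs m j, ∀ x, InBox (tlo L y j) (thi L y j) x → x ∈ i.Ω j) →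
      ∀ α₀ α₁ : ℝ, 0 < α₀ → 0 < α₁ → α₀ + α₁ ≤ c₁ →
      ∀ (U₀ : (zdGF3HP 𝔸 L β len i).Cfg) (P : (zdGF3HP 𝔸 L β len i).Pert) (φ : Φ), Adm i φ U₀.1 α₀ α₁ →
        (zdGF3HP 𝔸 L β len i).InA α₀ U₀ → (zdGF3HP 𝔸 L β len i).InAAx α₀ U₀ P → (zdGF3HP 𝔸 L β len i).avgClose166 α₁ U₀ P →
        ∃ u : (zdGF3HP 𝔸 L β len i).GT, (zdGF3HP 𝔸 L β len i).Restricted U₀ u ∧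
          ((zdGF3HP 𝔸 L β len i).C137 α₁ U₀ ((zdGF3HP 𝔸 L β len i).act P u) ∧
            LanF i U₀.1 φ i.k ((zdGF3HP 𝔸 L β len i).act P u).2.1 ∧
            (zdGF3HP 𝔸 L β len i).C162 (5 * (d : ℝ) * L * B₈) (α₀ + α₁) U₀ ((zdGF3HP 𝔸 L β len i).act P u)) ∧
          ∀ u' : (zdGF3HP 𝔸 L β len i).GT, (zdGF3HP 𝔸 L β len i).Restricted U₀ u' →
            LanF i U₀.1 φ i.k ((zdGF3HP 𝔸 L β len i).act P u').2.1 →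
            (zdGF3HP 𝔸 L β len i).C162 (5 * (d : ℝ) * L * B₈) (α₀ + α₁) U₀ ((zdGF3HP 𝔸 L β len i).act P u') → u' = u := by
  have hL1 : 1 ≤ L := le_trans (by norm_num) hL
  have hd1 : 1 ≤ d := le_trans (by norm_num) hd2
  have hL' : (1 : ℝ) ≤ L := by exact_mod_cast hL1
  obtain ⟨c₁, hc₁, H⟩ := thm4Body_concrete_uniform_lanE_γ' (𝔸 := 𝔸) hd2 hL hB₀ hB₀' hcu hcP (Φ := Φ) hγ' hB₈ hB₀8 hB hγB
  obtain ⟨cw', hcw', hw'⟩ := thm4_windows_extra (d := d) hL1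
  obtain ⟨cγ, hcγ, hwγ⟩ := thm4_windows_γ hd1 hL1 hB₈ hB₀' hB
  refine ⟨min c₁ (min cγ cw'), lt_min hc₁ (lt_min hcγ hcw'), ?_⟩
  intro i htw α₀ α₁ hα₀ hα₁ hs U₀ P φ hφ hInA hInAAx h166
  have hs₁ : α₀ + α₁ ≤ c₁ := hs.trans (min_le_left _ _)
  have hsγ : α₀ + α₁ ≤ cγ := hs.trans ((min_le_right _ _).trans (min_le_left _ _))
  have hsw' : α₀ + α₁ ≤ cw' := hs.trans ((min_le_right _ _).trans (min_le_right _ _))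
  obtain ⟨hP1, h34, hAx⟩ := hInAAx
  obtain ⟨h135, h66⟩ := h166
  subst hP1
  obtain ⟨u, hu, huS, h129, hLan, hleaf, huniq⟩ := H (Adm i) (LanF i) i.η i.hη i.k i.Ω i.hΩ i.Λs
    (fun m j => towerBondsP L i.Ω (i.Λs m) j) (B8TowerBondsPrinted.ZdIdx.towerBondsP_laws i).1 (B8TowerBondsPrinted.ZdIdx.towerBondsP_laws i).2 i.htower i.hpart htw
    (SP5base i) (SP5 i) (SH59src i) (SP5u i) α₀ α₁ hα₀ hα₁ hs₁ P.1.1 P.2.1 P.1.2 P.2.2 φ hφ hInA h34 hAx h135 h66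
  -- windows for the γ′ (1.42) lemma (at the enlarged constant `B₈`; [3] Prop. 4 at `(L²α₀, L·α₂)`)
  obtain ⟨g3, g4, g16, gsmall, gc₃, -, -⟩ :=
    hwγ α₀ α₁ hα₀ hα₁ hsγ (5 * (d : ℝ) * L * B₈ * (α₀ + α₁)) (8 * B₀' * (5 * (d : ℝ) * L * B₈) * (α₀ + α₁)) rfl rfl
  obtain ⟨w19, -⟩ := hw' α₀ α₁ hα₀ hα₁ hsw'
  have hcs0 : 0 ≤ 5 * (d : ℝ) * L * B₈ * (α₀ + α₁) := by positivity
  have hKS0 : 0 ≤ 2 * (L * (5 * (d : ℝ) * L * B₈ * (α₀ + α₁))) + 8 * (8 * B₀' * (5 * (d : ℝ) * L * B₈) * (α₀ + α₁)) := by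
    positivity
  have hcK : 5 * (d : ℝ) * L * B₈ * (α₀ + α₁) ≤
      2 * (L * (5 * (d : ℝ) * L * B₈ * (α₀ + α₁))) + 8 * (8 * B₀' * (5 * (d : ℝ) * L * B₈) * (α₀ + α₁)) := by
    have h₁ : (1 : ℝ) * (5 * (d : ℝ) * L * B₈ * (α₀ + α₁)) ≤ L * (5 * (d : ℝ) * L * B₈ * (α₀ + α₁)) :=
      mul_le_mul_of_nonneg_right hL' hcs0
    have h₂ : 0 ≤ 8 * (8 * B₀' * (5 * (d : ℝ) * L * B₈) * (α₀ + α₁)) := by positivity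
    linarith
  have hc16 : 16 * (5 * (d : ℝ) * L * B₈ * (α₀ + α₁)) ≤ 1 := by
    have hLα : 2 * (L * (5 * (d : ℝ) * L * B₈ * (α₀ + α₁))) + 8 * (8 * B₀' * (5 * (d : ℝ) * L * B₈) * (α₀ + α₁)) ≤
        (L : ℝ) * (2 * (L * (5 * (d : ℝ) * L * B₈ * (α₀ + α₁))) + 8 * (8 * B₀' * (5 * (d : ℝ) * L * B₈) * (α₀ + α₁))) := by
      have := mul_le_mul_of_nonneg_right hL' hKS0
      linarith
    linarith
  -- the gauge-fixed field and its CANONICAL masked exponent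
  have hW : mgauge P.1.1 u (mgauge P.1.1 u⁻¹ P.2.1) = P.2.1 := mgauge_mgauge_inv P.1.1 P.2.1 u
  have hWu : ∀ x κ, mgauge P.1.1 u⁻¹ P.2.1 x κ ∈ unitaryUnits 𝔸 := mem_unitaryUnits_of_mgauge_eq P.1.2 P.2.2 hu hW
  have hWA : ∀ j, j ≤ i.k → ∀ y τ, SideTouches (i.Ω j) y τ →
      mgauge P.1.1 u⁻¹ P.2.1 y τ = cfgExp i.η (logCfg i.η (mgauge P.1.1 u⁻¹ P.2.1)) y τ ∧
        ‖logCfg i.η (mgauge P.1.1 u⁻¹ P.2.1) y τ‖ ≤ (5 * (d : ℝ) * L * B₈ * (α₀ + α₁)) * ((L : ℝ) ^ j * i.η)⁻¹ :=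
    fun j hj y τ h => ⟨(hleaf j hj (y, τ) h).1, (hleaf j hj (y, τ) h).2.2⟩
  obtain ⟨hA'sa, hA'eq, hA'zero⟩ := mlogCfg_spec i.hη hL1 i.k P.1.1 hWu hcs0 hc16 i.Ω hWA
  set A' := mlogCfg i.k i.η i.Ω (mgauge P.1.1 u⁻¹ P.2.1) with hA'_def
  have hA'bd : ∀ j, j ≤ i.k → ∀ y τ, SideTouches (i.Ω j) y τ →
      mgauge P.1.1 u⁻¹ P.2.1 y τ = cfgExp i.η A' y τ ∧
        ‖A' y τ‖ ≤ (2 * (L * (5 * (d : ℝ) * L * B₈ * (α₀ + α₁))) + 8 * (8 * B₀' * (5 * (d : ℝ) * L * B₈) * (α₀ + α₁))) *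
          ((L : ℝ) ^ j * i.η)⁻¹ := by
    intro j hj y τ h
    obtain ⟨hAA, hWexp⟩ := hA'eq j hj y τ h
    refine ⟨hWexp, ?_⟩
    rw [hAA]
    have hη0 : 0 ≤ i.η := i.hη.le
    exact ((hWA j hj y τ h).2).trans (mul_le_mul_of_nonneg_right hcK (by positivity))
  have h137 := B8Eq142KLevelLocalGammaPrime.H42_of_inAx_γ' hd2 i.hη hL i.k P.1.2 hα₀ hα₁ hKS0 g3 g4 g16 gsmall gc₃ w19 i.Ω i.hΩ i.Λs
    (fun m j => towerBondsP L i.Ω (i.Λs m) j) (B8TowerBondsPrinted.ZdIdx.towerBondsP_laws i).1 (B8TowerBondsPrinted.ZdIdx.towerBondsP_laws i).2 hInA h34 hAx h135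
    (fun m W => LanF i P.1.1 φ m W) i.k i.hk le_rfl (htw i.k le_rfl) u
    (mgauge P.1.1 u⁻¹ P.2.1) A' hu hW h129 (hLan i.hk) hA'sa hA'bd hA'zero
  refine ⟨⟨u, hu, huS⟩, h129, ⟨h137, hLan i.hk, ?_⟩, ?_⟩
  · intro j hj b hb
    exact hleaf j hj b hb
  · intro u' hR' hLan' h162'
    apply Subtype.ext
    refine huniq u'.1 u'.2.1 u'.2.2 hR' hLan' ⟨logCfg i.η (mgauge P.1.1 u'.1⁻¹ P.2.1), fun j hj x κ h => ?_⟩ i.hk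
    exact ⟨(h162' j hj (x, κ) h).1, (h162' j hj (x, κ) h).2.2⟩

/-- ★★ **THE SAME CORE OVER AN INDEX MAP `ι : J → ZdIdx d L` (EDITION γ′)** — `thm4Core_zdGF3HP_lanE_γ'` with admissibility `Adm`, gauge predicate `LanF` and the
four sourced sockets `SP5base`∕`SP5`∕`SH59src`∕`SP5u` indexed by `J` and demanded AT `ι a` ONLY (the sockets in the γ′ letters: one-end-point (1.35) antecedent,
`SH59src`'s `|B₁|` over print's class `towerBondsP L (ι a).Ω ((ι a).Λs m) ·`; the member `ι a` supplies its tower law at every truncation): ONE threshold `c₁`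
(constants only) such that at every `a : J` the P-carrier's (1.33) ∕ (1.34) ∕ (1.35)+(1.66)₀ at `(α₀, α₁)` and an admitted source `φ` give a restricted `u` with
(1.37) `C137 α₁` in print's class, `LanF a U₀ φ (ι a).k` for `U′^{u⁻¹}`, the (1.62)-shape `C162 (5dL·B₈) (α₀ + α₁)`, unique among restricted competitors with
the gauge condition and the (1.62)-shape — the shape this seat's Theorem-8 knit `B8Thm8SurvivingZd3MapHE` reads, for its γ′ twin.  PROOF
(`B8Thm8SurvivingZd3MapHE.thm4Core_zd3_map_lanE`'s three lines verbatim): the ∀-theorem at the source index `J × Φ`, `Adm′ i (a, φ) := ι a = i ∧ Adm a φ`,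
`LanF′ i U₀ (a, φ) := LanF a U₀ φ` — its ∀-sockets hold vacuously off the range of `ι` and are the `J`-sockets on it.
[cite: Balaban1985RegularSpaces, Thm 8 (1.146) p.101, Thm 4 p.88, (1.29) p.81, (1.31) p.82, (1.35) p.82, (1.37)–(1.38) p.82, (1.62) p.87, Prop. 5 p.94, p.77; Balaban1985BackgroundPropagators, Thm 3.3 p.398] -/
theorem thm4Core_zdGF3HP_map_lanE_γ' (hd2 : 2 ≤ d) {L : ℕ} (hL : 2 ≤ L) {β : ℝ} {len : Site d → ℝ} {B₀ B₀' cu cP : ℝ} (hB₀ : 0 < B₀)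
    (hB₀' : 0 < B₀') (hcu : 0 < cu) (hcP : 0 < cP)
    {Φ : Type*} {γ' B₈ : ℝ} (hγ' : 0 ≤ γ') (hB₈ : 0 < B₈) (hB₀8 : B₀ ≤ B₈) (hB : 2 ≤ 5 * (d : ℝ) * L * B₈)
    (hγB : 5 * (d : ℝ) * L * B₀ + 2 * (γ' * B₀) ≤ 5 * (d : ℝ) * L * B₈)
    {J : Type} (ι : J → ZdIdx d L)
    (Adm : J → Φ → (Site d → Fin d → 𝔸ˣ) → ℝ → ℝ → Prop)
    (LanF : J → (Site d → Fin d → 𝔸ˣ) → Φ → ℕ → (Site d → Fin d → 𝔸ˣ) → Prop)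
    (SP5base : ∀ a : J, ∀ α₀ α₁ : ℝ, 0 < α₀ → 0 < α₁ → α₀ + α₁ ≤ cP →
      ∀ U₀ U' : Site d → Fin d → 𝔸ˣ, (∀ x κ, U₀ x κ ∈ unitaryUnits 𝔸) → (∀ x κ, U' x κ ∈ unitaryUnits 𝔸) →
      ∀ φ : Φ, Adm a φ U₀ α₀ α₁ →
      InAk L (ι a).k (ι a).η α₀ (ι a).Ω U₀ → InAk L (ι a).k (ι a).η α₀ (ι a).Ω (mulCfg U' U₀) → (∀ m, m ≤ (ι a).k → InAx L m ((ι a).Λs m) U₀ (mulCfg U' U₀)) →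
      (∀ j, j ≤ (ι a).k → ∀ (z : Site d) (μ : Fin d),
        ((∀ x, InBox (tlo L z j) (thi L z j) x → x ∈ (ι a).Ω j) ∨ (∀ x, InBox (tlo L (z + e μ) j) (thi L (z + e μ) j) x → x ∈ (ι a).Ω j)) →
        ‖(avgIter L (mulCfg U' U₀) j z μ : 𝔸) - (avgIter L U₀ j z μ : 𝔸)‖ ≤ α₁) →
      (∀ b ∈ {b : Site d × Fin d | SideTouches ((ι a).Ω 0) b.1 b.2}, ‖((U' b.1 b.2 : 𝔸ˣ) : 𝔸) - 1‖ ≤ α₁) →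
      (∃ (v : Site d → 𝔸ˣ) (lam : Site d → 𝔸), (∀ x, v x ∈ unitaryUnits 𝔸) ∧ (∀ x, x ∉ (ι a).Ω 0 → v x = 1) ∧
        (∀ j, j ≤ 1 → ∀ b ∈ {b : Site d × Fin d | SideTouches ((ι a).Ω j) b.1 b.2}, (v b.1 : 𝔸) = ((gaugeExp lam b.1 : 𝔸ˣ) : 𝔸) ∧
        (v (b.1 + e b.2) : 𝔸) = ((gaugeExp lam (b.1 + e b.2) : 𝔸ˣ) : 𝔸)) ∧
        (∀ j, j ≤ 1 → ∀ b ∈ {b : Site d × Fin d | SideTouches ((ι a).Ω j) b.1 b.2},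
        ‖lam b.1‖ ≤ (8 * B₀' * (5 * (d : ℝ) * L * B₈) * (α₀ + α₁)) ∧ ((L : ℝ) ^ j * (ι a).η) * ‖covDerivFwd (ι a).η U₀ b.2 lam b.1‖ ≤ (8 * B₀' * (5 * (d : ℝ) * L * B₈) * (α₀ + α₁))) ∧
        LanF a U₀ φ 1 (mgauge U₀ v⁻¹ U') ∧ Restr129 L 1 ((ι a).Λs 1) U₀ ((1 : Site d → 𝔸ˣ) * v)))
    (SP5 : ∀ a : J, ∀ α₀ α₁ : ℝ, 0 < α₀ → 0 < α₁ → α₀ + α₁ ≤ cP →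
      ∀ U₀ U' : Site d → Fin d → 𝔸ˣ, (∀ x κ, U₀ x κ ∈ unitaryUnits 𝔸) → (∀ x κ, U' x κ ∈ unitaryUnits 𝔸) →
      ∀ φ : Φ, Adm a φ U₀ α₀ α₁ →
      InAk L (ι a).k (ι a).η α₀ (ι a).Ω U₀ → InAk L (ι a).k (ι a).η α₀ (ι a).Ω (mulCfg U' U₀) → (∀ m, m ≤ (ι a).k → InAx L m ((ι a).Λs m) U₀ (mulCfg U' U₀)) →
      (∀ j, j ≤ (ι a).k → ∀ (z : Site d) (μ : Fin d),
        ((∀ x, InBox (tlo L z j) (thi L z j) x → x ∈ (ι a).Ω j) ∨ (∀ x, InBox (tlo L (z + e μ) j) (thi L (z + e μ) j) x → x ∈ (ι a).Ω j)) →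
        ‖(avgIter L (mulCfg U' U₀) j z μ : 𝔸) - (avgIter L U₀ j z μ : 𝔸)‖ ≤ α₁) →
      (∀ b ∈ {b : Site d × Fin d | SideTouches ((ι a).Ω 0) b.1 b.2}, ‖((U' b.1 b.2 : 𝔸ˣ) : 𝔸) - 1‖ ≤ α₁) →
      (∀ m, 1 ≤ m → m < (ι a).k → ∀ (u₁ : Site d → 𝔸ˣ) (U₁ : Site d → Fin d → 𝔸ˣ) (A : Site d → Fin d → 𝔸),
        (∀ x, u₁ x ∈ unitaryUnits 𝔸) → (∀ x, x ∉ (ι a).Ω 0 → u₁ x = 1) → mgauge U₀ u₁ U₁ = U' → Restr129 L m ((ι a).Λs m) U₀ u₁ →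
        LanF a U₀ φ m U₁ →
        (∀ j, j ≤ m → ∀ b ∈ {b : Site d × Fin d | SideTouches ((ι a).Ω j) b.1 b.2},
        U₁ b.1 b.2 = cfgExp (ι a).η A b.1 b.2 ∧ IsSelfAdjoint (A b.1 b.2) ∧ ‖A b.1 b.2‖ ≤ (5 * (d : ℝ) * L * B₈ * (α₀ + α₁)) * ((L : ℝ) ^ j * (ι a).η)⁻¹) →
        ∃ (v : Site d → 𝔸ˣ) (lam : Site d → 𝔸), (∀ x, v x ∈ unitaryUnits 𝔸) ∧ (∀ x, x ∉ (ι a).Ω 0 → v x = 1) ∧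
        (∀ j, j ≤ m + 1 → ∀ b ∈ {b : Site d × Fin d | SideTouches ((ι a).Ω j) b.1 b.2}, (v b.1 : 𝔸) = ((gaugeExp lam b.1 : 𝔸ˣ) : 𝔸) ∧
        (v (b.1 + e b.2) : 𝔸) = ((gaugeExp lam (b.1 + e b.2) : 𝔸ˣ) : 𝔸)) ∧
        (∀ j, j ≤ m + 1 → ∀ b ∈ {b : Site d × Fin d | SideTouches ((ι a).Ω j) b.1 b.2},
        ‖lam b.1‖ ≤ (8 * B₀' * (5 * (d : ℝ) * L * B₈) * (α₀ + α₁)) ∧ ((L : ℝ) ^ j * (ι a).η) * ‖covDerivFwd (ι a).η U₀ b.2 lam b.1‖ ≤ (8 * B₀' * (5 * (d : ℝ) * L * B₈) * (α₀ + α₁))) ∧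
        LanF a U₀ φ (m + 1) (mgauge U₀ v⁻¹ U₁) ∧ Restr129 L (m + 1) ((ι a).Λs (m + 1)) U₀ (u₁ * v)))
    (SH59src : ∀ a : J, ∀ α₀ α₁ : ℝ, 0 < α₀ → 0 < α₁ → α₀ + α₁ ≤ cP →
      ∀ U₀ U' : Site d → Fin d → 𝔸ˣ, (∀ x κ, U₀ x κ ∈ unitaryUnits 𝔸) → (∀ x κ, U' x κ ∈ unitaryUnits 𝔸) →
      ∀ φ : Φ, Adm a φ U₀ α₀ α₁ →
      InAk L (ι a).k (ι a).η α₀ (ι a).Ω U₀ → InAk L (ι a).k (ι a).η α₀ (ι a).Ω (mulCfg U' U₀) → (∀ m, m ≤ (ι a).k → InAx L m ((ι a).Λs m) U₀ (mulCfg U' U₀)) →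
      (∀ j, j ≤ (ι a).k → ∀ (z : Site d) (μ : Fin d),
        ((∀ x, InBox (tlo L z j) (thi L z j) x → x ∈ (ι a).Ω j) ∨ (∀ x, InBox (tlo L (z + e μ) j) (thi L (z + e μ) j) x → x ∈ (ι a).Ω j)) →
        ‖(avgIter L (mulCfg U' U₀) j z μ : 𝔸) - (avgIter L U₀ j z μ : 𝔸)‖ ≤ α₁) →
      (∀ b ∈ {b : Site d × Fin d | SideTouches ((ι a).Ω 0) b.1 b.2}, ‖((U' b.1 b.2 : 𝔸ˣ) : 𝔸) - 1‖ ≤ α₁) →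
      (∀ m, 1 ≤ m → m ≤ (ι a).k → ∀ (u : Site d → 𝔸ˣ) (W : Site d → Fin d → 𝔸ˣ) (A' : Site d → Fin d → 𝔸),
        (∀ x, u x ∈ unitaryUnits 𝔸) → mgauge U₀ u W = U' → Restr129 L m ((ι a).Λs m) U₀ u → LanF a U₀ φ m W →
        (∀ y τ, IsSelfAdjoint (A' y τ)) →
        (∀ j, j ≤ m → ∀ y τ, SideTouches ((ι a).Ω j) y τ →
        W y τ = cfgExp (ι a).η A' y τ ∧ ‖A' y τ‖ ≤ (2 * (L * (5 * (d : ℝ) * L * B₈ * (α₀ + α₁))) + 8 * (8 * B₀' * (5 * (d : ℝ) * L * B₈) * (α₀ + α₁))) * ((L : ℝ) ^ j * (ι a).η)⁻¹) →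
        (∀ y τ, (∀ j, j ≤ m → ¬ SideTouches ((ι a).Ω j) y τ) → A' y τ = 0) →
        msup L m (ι a).η (-(1 : ℝ)) (fun j (b : Site d × Fin d) => SideTouches ((ι a).Ω j) b.1 b.2) (fun b => A' b.1 b.2)
        ≤ B₀ * (bondNorm L m (ι a).η (-(3 : ℝ)) (ι a).Ω (fun x μ => Jcur (ι a).η U₀ A' μ x)
        + wsup 1 (fun p : {p : ℕ × (Site d × Fin d) // p.1 ≤ m ∧ p.2 ∈ towerBondsP L (ι a).Ω ((ι a).Λs m) p.1} =>
        linCovIter L U₀ (iEta (ι a).η A') p.1.1 p.1.2.1 p.1.2.2)) + γ' * B₀ * (α₀ + α₁) ∧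
        msup L m (ι a).η (-(2 : ℝ)) (fun j (t : Fin d × Fin d × Site d) => SideTouches ((ι a).Ω j) t.2.2 t.2.1)
        (fun t => covDerivFwd (ι a).η U₀ t.1 (fun z => A' z t.2.1) t.2.2)
        ≤ B₀ * (bondNorm L m (ι a).η (-(3 : ℝ)) (ι a).Ω (fun x μ => Jcur (ι a).η U₀ A' μ x)
        + wsup 1 (fun p : {p : ℕ × (Site d × Fin d) // p.1 ≤ m ∧ p.2 ∈ towerBondsP L (ι a).Ω ((ι a).Λs m) p.1} =>
        linCovIter L U₀ (iEta (ι a).η A') p.1.1 p.1.2.1 p.1.2.2)) + γ' * B₀ * (α₀ + α₁)))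
    (SP5u : ∀ a : J, ∀ α₀ α₁ : ℝ, 0 < α₀ → 0 < α₁ → α₀ + α₁ ≤ cP →
      ∀ U₀ U' : Site d → Fin d → 𝔸ˣ, (∀ x κ, U₀ x κ ∈ unitaryUnits 𝔸) → (∀ x κ, U' x κ ∈ unitaryUnits 𝔸) →
      ∀ φ : Φ, Adm a φ U₀ α₀ α₁ →
      InAk L (ι a).k (ι a).η α₀ (ι a).Ω U₀ → InAk L (ι a).k (ι a).η α₀ (ι a).Ω (mulCfg U' U₀) → (∀ m, m ≤ (ι a).k → InAx L m ((ι a).Λs m) U₀ (mulCfg U' U₀)) →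
      (∀ j, j ≤ (ι a).k → ∀ (z : Site d) (μ : Fin d),
        ((∀ x, InBox (tlo L z j) (thi L z j) x → x ∈ (ι a).Ω j) ∨ (∀ x, InBox (tlo L (z + e μ) j) (thi L (z + e μ) j) x → x ∈ (ι a).Ω j)) →
        ‖(avgIter L (mulCfg U' U₀) j z μ : 𝔸) - (avgIter L U₀ j z μ : 𝔸)‖ ≤ α₁) →
      (∀ b ∈ {b : Site d × Fin d | SideTouches ((ι a).Ω 0) b.1 b.2}, ‖((U' b.1 b.2 : 𝔸ˣ) : 𝔸) - 1‖ ≤ α₁) →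
      ∀ u₁ : Site d → 𝔸ˣ, (∀ x, u₁ x ∈ unitaryUnits 𝔸) → (∀ x, x ∉ (ι a).Ω 0 → u₁ x = 1) → Restr129 L (ι a).k ((ι a).Λs (ι a).k) U₀ u₁ →
      LanF a U₀ φ (ι a).k (mgauge U₀ u₁⁻¹ U') →
      (∃ A₁ : Site d → Fin d → 𝔸, ∀ j, j ≤ (ι a).k → ∀ (x : Site d) (κ : Fin d), SideTouches ((ι a).Ω j) x κ →
        mgauge U₀ u₁⁻¹ U' x κ = cfgExp (ι a).η A₁ x κ ∧ ‖A₁ x κ‖ ≤ (5 * (d : ℝ) * L * B₈ * (α₀ + α₁)) * ((L : ℝ) ^ j * (ι a).η)⁻¹) →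
      ∀ (v w : Site d → 𝔸ˣ) (lam mu : Site d → 𝔸),
      (∀ x, ((gaugeExp lam x : 𝔸ˣ) : 𝔸) = ((v x : 𝔸ˣ) : 𝔸) ∧ IsSelfAdjoint (lam x) ∧ ‖lam x‖ < cu) → (∀ x, x ∉ (ι a).Ω 0 → lam x = 0) →
      (∀ j, j ≤ (ι a).k → ∀ b ∈ {b : Site d × Fin d | SideTouches ((ι a).Ω j) b.1 b.2}, ((L : ℝ) ^ j * (ι a).η) * ‖covDerivFwd (ι a).η U₀ b.2 lam b.1‖ < cu) →
      (∀ x, ((gaugeExp mu x : 𝔸ˣ) : 𝔸) = ((w x : 𝔸ˣ) : 𝔸) ∧ IsSelfAdjoint (mu x) ∧ ‖mu x‖ < cu) → (∀ x, x ∉ (ι a).Ω 0 → mu x = 0) →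
      (∀ j, j ≤ (ι a).k → ∀ b ∈ {b : Site d × Fin d | SideTouches ((ι a).Ω j) b.1 b.2}, ((L : ℝ) ^ j * (ι a).η) * ‖covDerivFwd (ι a).η U₀ b.2 mu b.1‖ < cu) →
      LanF a U₀ φ (ι a).k (mgauge U₀ v⁻¹ (mgauge U₀ u₁⁻¹ U')) → Restr129 L (ι a).k ((ι a).Λs (ι a).k) U₀ (u₁ * v) →
      LanF a U₀ φ (ι a).k (mgauge U₀ w⁻¹ (mgauge U₀ u₁⁻¹ U')) → Restr129 L (ι a).k ((ι a).Λs (ι a).k) U₀ (u₁ * w) →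
      ∀ x, v x = w x) :
    ∃ c₁ : ℝ, 0 < c₁ ∧ ∀ a : J,
      -- the tower law at EVERY truncation of the member `ι a` ((1.5)–(1.6) p. 77; `IdxB8Sub.tower_all` at the law members)
      (∀ m, m ≤ (ι a).k → ∀ j, j ≤ m → ∀ y ∈ (ι a).Λs m j, ∀ x, InBox (tlo L y j) (thi L y j) x → x ∈ (ι a).Ω j) →
      ∀ α₀ α₁ : ℝ, 0 < α₀ → 0 < α₁ → α₀ + α₁ ≤ c₁ →
      ∀ (U₀ : (zdGF3HP 𝔸 L β len (ι a)).Cfg) (P : (zdGF3HP 𝔸 L β len (ι a)).Pert) (φ : Φ), Adm a φ U₀.1 α₀ α₁ →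
        (zdGF3HP 𝔸 L β len (ι a)).InA α₀ U₀ → (zdGF3HP 𝔸 L β len (ι a)).InAAx α₀ U₀ P → (zdGF3HP 𝔸 L β len (ι a)).avgClose166 α₁ U₀ P →
        ∃ u : (zdGF3HP 𝔸 L β len (ι a)).GT, (zdGF3HP 𝔸 L β len (ι a)).Restricted U₀ u ∧
          ((zdGF3HP 𝔸 L β len (ι a)).C137 α₁ U₀ ((zdGF3HP 𝔸 L β len (ι a)).act P u) ∧
            LanF a U₀.1 φ (ι a).k ((zdGF3HP 𝔸 L β len (ι a)).act P u).2.1 ∧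
            (zdGF3HP 𝔸 L β len (ι a)).C162 (5 * (d : ℝ) * L * B₈) (α₀ + α₁) U₀ ((zdGF3HP 𝔸 L β len (ι a)).act P u)) ∧
          ∀ u' : (zdGF3HP 𝔸 L β len (ι a)).GT, (zdGF3HP 𝔸 L β len (ι a)).Restricted U₀ u' →
            LanF a U₀.1 φ (ι a).k ((zdGF3HP 𝔸 L β len (ι a)).act P u').2.1 →
            (zdGF3HP 𝔸 L β len (ι a)).C162 (5 * (d : ℝ) * L * B₈) (α₀ + α₁) U₀ ((zdGF3HP 𝔸 L β len (ι a)).act P u') → u' = u := by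
  obtain ⟨c₁, hc₁, H⟩ := thm4Core_zdGF3HP_lanE_γ' (𝔸 := 𝔸) (β := β) (len := len) hd2 hL hB₀ hB₀' hcu hcP (Φ := J × Φ) hγ' hB₈ hB₀8 hB
    hγB (fun i p U₀ a0 b0 => ι p.1 = i ∧ Adm p.1 p.2 U₀ a0 b0) (fun i U₀ p m W => LanF p.1 U₀ p.2 m W)
    (by
      intro i α₀ α₁ hα₀ hα₁ hs U₀ U' hU₀ hU' p hp
      obtain ⟨hi, hφ⟩ := hp
      subst hi
      exact SP5base p.1 α₀ α₁ hα₀ hα₁ hs U₀ U' hU₀ hU' p.2 hφ)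
    (by
      intro i α₀ α₁ hα₀ hα₁ hs U₀ U' hU₀ hU' p hp
      obtain ⟨hi, hφ⟩ := hp
      subst hi
      exact SP5 p.1 α₀ α₁ hα₀ hα₁ hs U₀ U' hU₀ hU' p.2 hφ)
    (by
      intro i α₀ α₁ hα₀ hα₁ hs U₀ U' hU₀ hU' p hp
      obtain ⟨hi, hφ⟩ := hp
      subst hi
      exact SH59src p.1 α₀ α₁ hα₀ hα₁ hs U₀ U' hU₀ hU' p.2 hφ)
    (by
      intro i α₀ α₁ hα₀ hα₁ hs U₀ U' hU₀ hU' p hp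
      obtain ⟨hi, hφ⟩ := hp
      subst hi
      exact SP5u p.1 α₀ α₁ hα₀ hα₁ hs U₀ U' hU₀ hU' p.2 hφ)
  exact ⟨c₁, hc₁, fun a htw α₀ α₁ hα₀ hα₁ hs U₀ P φ hφ => H (ι a) htw α₀ α₁ hα₀ hα₁ hs U₀ P (a, φ) ⟨rfl, hφ⟩⟩

end Core

#print axioms thm4Core_zdGF3HP_lanE_γ'
#print axioms thm4Core_zdGF3HP_map_lanE_γ'

end Literature.MathematicalPhysics.QuantumFieldTheory.Balaban1983to89.B8Thm4CoreZdGF3HPLanEGamma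

end
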